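import Mathlib
import HarnessLib
import Summits.ValiantsHypothesis.ValiantsHypothesis.Theses.MonotoneRestoration
import Literature.Computability.AlgebraicComplexity.ArithCircuit
import Literature.Computability.AlgebraicComplexity.ArithCircuitProofs
import Literature.Computability.AlgebraicComplexity.MonotoneStructure
import Literature.Computability.AlgebraicComplexity.PermanentIrreducible
import Literature.ModelTheory.FiniteModelTheory.CkEquiv
import Summits.ValiantsHypothesis.ValiantsHypothesis.Theorems.MonotoneRestorationMonotoneRestorationQPCosetCount
import Summits.ValiantsHypothesis.ValiantsHypothesis.Theorems.MonotoneRestorationMonotoneRestorationQPSymmetricLB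
import Summits.ValiantsHypothesis.ValiantsHypothesis.Theorems.MonotoneRestorationMonotoneRestorationQPSupportSymmetrisation
import Summits.ValiantsHypothesis.ValiantsHypothesis.Theorems.MonotoneRestorationMonotoneRestorationQPSparseRegime
import Summits.ValiantsHypothesis.ValiantsHypothesis.Theorems.MonotoneRestorationMonotoneRestorationQPBeta
import Literature.Computability.AlgebraicComplexity.SymmetricArithCircuit
import Literature.Computability.AlgebraicComplexity.DawarWilsenach2025Proofs
import Literature.GroupTheory.PermutationGroups.SmallIndexSubgroups
import Summits.ValiantsHypothesis.ValiantsHypothesis.Theorems.MonotoneRestorationQP.Negative.LoadBearing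
import Summits.ValiantsHypothesis.ValiantsHypothesis.Theorems.MonotoneRestorationMonotoneRestorationQPPermSupportCount
import Summits.ValiantsHypothesis.ValiantsHypothesis.Theorems.MonotoneRestorationMonotoneRestorationQPVariants19048Neg

/-! TTRL-lite variant V19050 of stmt-ValiantsHypothesis-15886

Move `generalise` (`[thr4_false]`): the stub `stub_altFixing_orbit_dichotomy` with the largeness
hypothesis weakened from `|X| + 9 ≤ n` to `|X| + 4 ≤ n`.  This is the BOUNDARY and it is FALSE:
threshold `4` admits `n = 4`, `X = ∅`, where the Klein four-group `V₄ ◁ A₄` has index `3 < 4`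
and yields a `3`-element orbit.  Together with the (true) threshold-`5` variant this pins the
threshold exactly.  The negation is obtained by specialising to `n = 4`, `X = ∅` and invoking the
landed small-case refutation `stub_altFixing_orbit_dichotomy_var19048_false`.
-/

-- `Summit.ValiantsHypothesis.ValiantsHypothesis.…` is the tree's mandated single-conjunct layout
-- (Sub = Summit), so the duplicated namespace component is intended.
set_option linter.dupNamespace false

namespace Summit.ValiantsHypothesis.ValiantsHypothesis.Theorems

open Summit.ValiantsHypothesis.ValiantsHypothesis.Theses.MonotoneRestoration
open Literature.Computability.AlgebraicComplexity

/-- **TTRL-lite variant V19050 of `stub_altFixing_orbit_dichotomy` is FALSE** (move `generalise`,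
largeness hypothesis weakened to `|X| + 4 ≤ n`).

Witness: `n = 4`, `X = ∅` (so `|X| + 4 ≤ n` holds and the pointwise-stabiliser condition is
vacuous); then the statement is literally the small case `n = 4`, `|T| < 4` refuted in
`stub_altFixing_orbit_dichotomy_var19048_false` (`K = ℕ`, `q = x_{01} + x_{10} + x_{23} + x_{32}`,
`T` = the three perfect-matching polynomials of `Fin 4`, and the even `3`-cycle `(0 1)(1 2)` moves
`q`): `Alt(Fin 4)` has the index-`3` subgroup `V₄`, so an orbit of size `3 < n - |X| = 4` that is
not a fixed point exists.  Hence the `m`-threshold of the orbit dichotomy is exactly `5`. -/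
theorem stub_altFixing_orbit_dichotomy_var19050_false :
    ¬ (∀ (n : ℕ) (K : Type) [CommSemiring K] (q : MvPolynomial (Fin n × Fin n) K)
        (X : Finset (Fin n)), X.card + 4 ≤ n →
        ∀ (T : Finset (MvPolynomial (Fin n × Fin n) K)), T.card + X.card < n →
        (∀ ρ : Equiv.Perm (Fin n), (∀ x ∈ X, ρ x = x) → Equiv.Perm.sign ρ = 1 →
          MvPolynomial.rename (fun p : Fin n × Fin n => (ρ p.1, ρ p.2)) q ∈ T) →
        ∀ ρ : Equiv.Perm (Fin n), (∀ x ∈ X, ρ x = x) → Equiv.Perm.sign ρ = 1 →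
          MvPolynomial.rename (fun p : Fin n × Fin n => (ρ p.1, ρ p.2)) q = q) := by
  intro h
  apply stub_altFixing_orbit_dichotomy_var19048_false
  intro K _ q T hT horb ρ hρ
  exact h 4 K q ∅ (by simp) T (by simpa using hT) (fun σ _ hσ => horb σ hσ) ρ
    (fun x hx => absurd hx (by simp)) hρ

end Summit.ValiantsHypothesis.ValiantsHypothesis.Theorems
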